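import Summits.QuantumAdvantage.QuantumAdvantage.Theses.SpinorFlattening
import Summits.QuantumAdvantage.QuantumAdvantage.Theorems.SpinorFlatteningNegApproxGaussRankSuperpolyMassBound
import Summits.QuantumAdvantage.QuantumAdvantage.Theorems.SpinorFlatteningNegApproxGaussRankSuperpolyNormalOrder
import Summits.QuantumAdvantage.QuantumAdvantage.Theorems.SpinorFlatteningNegApproxGaussRankSuperpolyFilterCard
import Summits.QuantumAdvantage.QuantumAdvantage.Theorems.SpinorFlatteningNegApproxGaussRankSuperpolyFlatOrthoOfInvariant
import Summits.QuantumAdvantage.QuantumAdvantage.Theorems.SpinorFlatteningNegApproxGaussRankSuperpolyMagicInvariant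
import Summits.QuantumAdvantage.QuantumAdvantage.Theorems.SpinorFlatteningNegApproxGaussRankSuperpolyCountGap
import Literature.Computability.QuantumComplexity.GaussianRank

/-!
# Crux `SpinorFlattening.FlatteningBoundRobust` (stmt-QuantumAdvantage-1246) — CANDIDATE PROOF (triage evidence)

Written by refuter-cruxtri-stmt-QuantumAdvantage-1246-r1-1-0 (crux-triage r1, triager 1) as EVIDENCE that the
crux is, as of 2026-08-16T02:24Z, a corollary of the six LANDED theorems of the sibling crux 1245's line
`spectral-mass-flattening` (`stub_normalOrder` p75761, `stub_filterCard` p74182, `stub_flatOrthoOfInvariant` p74600,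
`stub_magicInvariant` p74598, `stub_massBound` p71968, `countGap_card_sigma` p74656) plus the binomial inequality
`C(t,K)·8^K ≤ C(8t,K)`.  The wiring is that of the round-1 cards `isometric-subflattening-deficit` /
`mass-bound-corollary` / `isometric-subflattening-bessel` (Bessel mass bound on the isometric one-per-block
sub-flattening), indexed by the Σ-type (`K`-subset of blocks, labelling) whose cardinality is landed exactly.
NOT a refuter landing (positive statement): attached with `ledger workitem evidence`; a prover files it.
-/

set_option linter.dupNamespace false -- D-0017: single-problem summit ⇒ `QuantumAdvantage.QuantumAdvantage` by design

noncomputable section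

namespace Summit.QuantumAdvantage.QuantumAdvantage.Theorems.SpinorFlattening

open Matrix Finset
open Literature.Computability.QuantumComplexity Literature.Computability.Cryptography

/-- r-TERM DEFICIENCY from the landed `stub_normalOrder` + `stub_filterCard` (the skeleton's `deficiency_of_parts`). -/
theorem robust_deficiency :
    ∀ (n K r : ℕ) (a : Fin r → ℂ) (g : Fin r → QReg n → ℂ), (∀ i, IsGaussian (g i)) →
      ∃ W : Submodule ℂ (QReg n → ℂ), Module.finrank ℂ W ≤ r * flatteningDeficiency K n ∧
        ∀ l : List (Fin n × Bool), l.length = K →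
          (l.map fun p => majorana n p.1 p.2).prod *ᵥ (∑ i, a i • g i) ∈ W := by
  intro n K r a g hg
  classical
  choose u hu using fun i => stub_normalOrder n K (g i) (hg i)
  let ι : Type := {I : Finset (Fin n) // I.card ≤ K ∧ I.card % 2 = K % 2}
  let f : Fin r → ι → (QReg n → ℂ) := fun i I =>
    ((I.1.sort (· ≤ ·)).map fun j => ∑ p : Fin n × Bool, u i j p • majorana n p.1 p.2).prod *ᵥ g i
  let F : Fin r × ι → (QReg n → ℂ) := fun x => f x.1 x.2
  refine ⟨Submodule.span ℂ (Set.range F), ?_, ?_⟩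
  · calc Module.finrank ℂ (Submodule.span ℂ (Set.range F)) ≤ Fintype.card (Fin r × ι) :=
          finrank_range_le_card F
      _ = r * flatteningDeficiency K n := by rw [Fintype.card_prod, Fintype.card_fin, stub_filterCard]
  · intro l hl
    rw [Matrix.mulVec_sum]
    refine Submodule.sum_mem _ fun i _ => ?_
    rw [Matrix.mulVec_smul]
    refine Submodule.smul_mem _ _ ?_
    have hsub : Submodule.span ℂ (Set.range (f i)) ≤ Submodule.span ℂ (Set.range F) :=
      Submodule.span_mono (by
        rintro _ ⟨I, rfl⟩
        exact ⟨(i, I), rfl⟩)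
    exact hsub (hu i l hl)

/-- FULLNESS from the landed `stub_flatOrthoOfInvariant` + `stub_magicInvariant` (the skeleton's `flatOrthonormal_of_parts`). -/
theorem robust_flatOrthonormal :
    ∀ (t : ℕ) (mono : (Fin t → Option (Fin 4 × Bool)) → Matrix (QReg (t * 4)) (QReg (t * 4)) ℂ),
      (∀ s, mono s = ((List.finRange t).filterMap fun b =>
          (s b).map fun q => majorana (t * 4) (finProdFinEquiv (b, q.1)) q.2).prod) →
      (∀ s, star (mono s *ᵥ magicMPow t) ⬝ᵥ (mono s *ᵥ magicMPow t) = 1) ∧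
        ∀ s s', s ≠ s' → star (mono s *ᵥ magicMPow t) ⬝ᵥ (mono s' *ᵥ magicMPow t) = 0 := by
  intro t mono hmono
  obtain ⟨hX, hZ, h1⟩ := stub_magicInvariant t
  exact stub_flatOrthoOfInvariant t mono hmono (magicMPow t) hX hZ h1

/-- Labels of a block pattern: as many as excited blocks (verbatim from the skeleton). -/
theorem robust_length_filterMap_labels (t : ℕ) (s : Fin t → Option (Fin 4 × Bool)) :
    ((List.finRange t).filterMap fun b =>
        (s b).map fun q => ((finProdFinEquiv (b, q.1) : Fin (t * 4)), q.2)).length =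
      (univ.filter fun b => (s b).isSome).card := by
  classical
  have key : ∀ L : List (Fin t), (L.filterMap fun b =>
      (s b).map fun q => ((finProdFinEquiv (b, q.1) : Fin (t * 4)), q.2)).length =
        (L.filter fun b => (s b).isSome).length := by
    intro L
    induction L with
    | nil => simp
    | cons b L ih =>
      cases hb : s b with
      | none => simp [hb, ih]
      | some q => simp [hb, ih]
  rw [key, ← List.toFinset_card_of_nodup ((List.nodup_finRange t).filter _)]
  congr 1
  ext b
  simp

/-- Pascal iterated: `C(n, K+1) + m·C(n, K) ≤ C(n+m, K+1)` (from crux workfile Transfer.lean). [folklore] -/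
theorem robust_choose_succ_add_mul_le (n K : ℕ) : ∀ m : ℕ,
    n.choose (K + 1) + m * n.choose K ≤ (n + m).choose (K + 1)
  | 0 => by simp
  | m + 1 => by
    have ih := robust_choose_succ_add_mul_le n K m
    have hmono : n.choose K ≤ (n + m).choose K := Nat.choose_le_choose K (Nat.le_add_right n m)
    have hP : (n + (m + 1)).choose (K + 1) = (n + m).choose K + (n + m).choose (K + 1) := by
      rw [← Nat.add_assoc, Nat.choose_succ_succ']
    rw [hP]
    nlinarith [ih, hmono]

/-- `C(t,K)·8^K ≤ C(8t,K)` (from crux workfile Transfer.lean). [folklore] -/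
theorem robust_choose_mul_pow_le : ∀ t K : ℕ, t.choose K * 8 ^ K ≤ (t * 8).choose K
  | 0, 0 => by simp
  | 0, K + 1 => by simp
  | t + 1, 0 => by simp
  | t + 1, K + 1 => by
    have ih0 := robust_choose_mul_pow_le t K
    have ih1 := robust_choose_mul_pow_le t (K + 1)
    have hA := robust_choose_succ_add_mul_le (t * 8) K 8
    have hmul : (t + 1) * 8 = t * 8 + 8 := by ring
    have ih1' : t.choose (K + 1) * (8 ^ K * 8) ≤ (t * 8).choose (K + 1) := by
      rw [← pow_succ]; exact ih1
    rw [hmul, Nat.choose_succ_succ', pow_succ]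
    have hsplit : (t.choose K + t.choose (K + 1)) * (8 ^ K * 8) =
        8 * (t.choose K * 8 ^ K) + t.choose (K + 1) * (8 ^ K * 8) := by ring
    rw [hsplit]
    calc 8 * (t.choose K * 8 ^ K) + t.choose (K + 1) * (8 ^ K * 8)
        ≤ 8 * (t * 8).choose K + (t * 8).choose (K + 1) :=
          Nat.add_le_add (Nat.mul_le_mul_left 8 ih0) ih1'
      _ ≤ (t * 8 + 8).choose (K + 1) := by linarith [hA]

/-- The block pattern of a (`K`-subset of blocks, labelling) pair. -/
def robustPattern {t K : ℕ} (x : Σ B : {B : Finset (Fin t) // B.card = K}, (B.1 → Fin 4 × Bool)) :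
    Fin t → Option (Fin 4 × Bool) :=
  fun b => if h : b ∈ x.1.1 then some (x.2 ⟨b, h⟩) else none

/-- The pattern determines the pair (as in the landed `countGap_choose_mul_pow_le_card`). -/
theorem robustPattern_injective (t K : ℕ) :
    Function.Injective (robustPattern (t := t) (K := K)) := by
  rintro ⟨⟨B, hB⟩, f⟩ ⟨⟨B', hB'⟩, f'⟩ h
  have h' : (fun b => if h : b ∈ B then some (f ⟨b, h⟩) else none) =
      fun b => if h : b ∈ B' then some (f' ⟨b, h⟩) else none := h
  have hBB : B = B' := by
    ext b
    have hb : (if h : b ∈ B then some (f ⟨b, h⟩) else none) =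
        if h : b ∈ B' then some (f' ⟨b, h⟩) else none := congrFun h' b
    constructor
    · intro h1
      by_contra h2
      rw [dif_pos h1, dif_neg h2] at hb
      exact Option.some_ne_none _ hb
    · intro h2
      by_contra h1
      rw [dif_neg h1, dif_pos h2] at hb
      exact Option.some_ne_none _ hb.symm
  subst hBB
  have hff : f = f' := by
    funext x
    obtain ⟨b, hb⟩ := x
    have hx : (if h : b ∈ B then some (f ⟨b, h⟩) else none) =
        if h : b ∈ B then some (f' ⟨b, h⟩) else none := congrFun h' b
    rw [dif_pos hb, dif_pos hb, Option.some.injEq] at hx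
    exact hx
  subst hff
  rfl

/-- The pattern of a pair excites exactly `K` blocks. -/
theorem robustPattern_support {t K : ℕ} (x : Σ B : {B : Finset (Fin t) // B.card = K}, (B.1 → Fin 4 × Bool)) :
    (univ.filter fun b => (robustPattern x b).isSome).card = K := by
  unfold robustPattern
  rw [countGap_pattern_support]
  exact x.1.2

/-- **The crux `SpinorFlattening.FlatteningBoundRobust` (stmt-QuantumAdvantage-1246)** — Bessel mass bound on the
isometric one-per-block sub-flattening: with `ι` the degree-`K` flat family (`|ι| = C(t,K)·8^K`) and `W` the
normal-ordering deficiency subspace (`dim W ≤ r·D_K(4t)`), `|ι| − dim W ≤ |ι|·‖M^{⊗t} − φ‖²` and the hypothesis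
`r·D_K(4t) < C(t,K)·8^K` give `1 ≤ |ι|·‖M^{⊗t} − φ‖² ≤ C(8t,K)·‖M^{⊗t} − φ‖²`. -/
theorem flatteningBoundRobust :
    Summit.QuantumAdvantage.QuantumAdvantage.Theses.SpinorFlattening.FlatteningBoundRobust := by
  classical
  show ∀ t K r : ℕ, r * flatteningDeficiency K (t * 4) < t.choose K * 8 ^ K →
    ∀ (a : Fin r → ℂ) (g : Fin r → QReg (t * 4) → ℂ), (∀ i, IsGaussian (g i)) →
      (1 : ℝ) ≤ ((t * 8).choose K : ℝ) * normSq (magicMPow t - ∑ i, a i • g i)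
  intro t K r hcount a g hg
  -- the flat family: labels, monomials, index type
  let lab : (Fin t → Option (Fin 4 × Bool)) → List (Fin (t * 4) × Bool) := fun s =>
    (List.finRange t).filterMap fun b => (s b).map fun q => (finProdFinEquiv (b, q.1), q.2)
  let mono : (Fin t → Option (Fin 4 × Bool)) → Matrix (QReg (t * 4)) (QReg (t * 4)) ℂ := fun s =>
    ((List.finRange t).filterMap fun b =>
      (s b).map fun q => majorana (t * 4) (finProdFinEquiv (b, q.1)) q.2).prod
  have hmono_lab : ∀ s, mono s = ((lab s).map fun p => majorana (t * 4) p.1 p.2).prod := by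
    intro s
    simp only [mono, lab, List.map_filterMap, Option.map_map]
    rfl
  let ι : Type := Σ B : {B : Finset (Fin t) // B.card = K}, (B.1 → Fin 4 × Bool)
  -- deficiency subspace
  obtain ⟨W, hW, hmem⟩ := robust_deficiency (t * 4) K r a g hg
  -- unitarity of the monomials
  have hunit : ∀ s, mono s ∈ Matrix.unitaryGroup (QReg (t * 4)) ℂ := by
    intro s
    rw [hmono_lab]
    refine list_prod_mem ?_
    intro x hx
    obtain ⟨p, -, rfl⟩ := List.mem_map.1 hx
    exact majorana_mem_unitaryGroup _ _ _
  -- orthonormality of the images of M^{⊗t}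
  obtain ⟨hO1, hO2⟩ := robust_flatOrthonormal t mono (fun s => rfl)
  -- the mass bound over the Σ-indexed degree-K family
  have hmass := stub_massBound (t * 4) ι (fun x => mono (robustPattern x)) (magicMPow t) (∑ i, a i • g i) W
    (fun x => hunit _) (fun x => hO1 _)
    (fun x y hxy => hO2 _ _ fun h => hxy (robustPattern_injective t K h))
    (fun x => by
      show mono (robustPattern x) *ᵥ _ ∈ W
      rw [hmono_lab]
      exact hmem (lab (robustPattern x))
        ((robust_length_filterMap_labels t (robustPattern x)).trans (robustPattern_support x)))
  -- counting
  have hcardι : Fintype.card ι = t.choose K * 8 ^ K := countGap_card_sigma t K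
  have hfin : Module.finrank ℂ W + 1 ≤ Fintype.card ι := by
    rw [hcardι]
    exact lt_of_le_of_lt hW hcount
  have h1 : (1 : ℝ) ≤ (Fintype.card ι : ℝ) - Module.finrank ℂ W := by
    have := (Nat.cast_le (α := ℝ)).2 hfin
    push_cast at this
    linarith
  have hnn : 0 ≤ normSq (magicMPow t - ∑ i, a i • g i) :=
    Finset.sum_nonneg fun _ _ => by positivity
  have hle : (Fintype.card ι : ℝ) ≤ ((t * 8).choose K : ℝ) := by
    rw [hcardι]
    exact_mod_cast robust_choose_mul_pow_le t K
  calc (1 : ℝ) ≤ (Fintype.card ι : ℝ) - Module.finrank ℂ W := h1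
    _ ≤ Fintype.card ι * normSq (magicMPow t - ∑ i, a i • g i) := hmass
    _ ≤ ((t * 8).choose K : ℝ) * normSq (magicMPow t - ∑ i, a i • g i) :=
        mul_le_mul_of_nonneg_right hle hnn

/-- The SHARP (mass-bound / C⁺) form for the record: `C(t,K)8^K − r·D_K(4t) ≤ C(t,K)8^K·‖M^{⊗t} − φ‖²`,
hypothesis-free (= `FlatteningBoundBessel` of crux workfile Transfer.lean, hence also the kill crux 1245 via
`Transfer.negApprox_of_bessel'`). -/
theorem flatteningBoundBessel :
    ∀ t K r : ℕ, ∀ (a : Fin r → ℂ) (g : Fin r → QReg (t * 4) → ℂ), (∀ i, IsGaussian (g i)) →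
      ((t.choose K * 8 ^ K : ℕ) : ℝ) - ((r * flatteningDeficiency K (t * 4) : ℕ) : ℝ)
        ≤ ((t.choose K * 8 ^ K : ℕ) : ℝ) * normSq (magicMPow t - ∑ i, a i • g i) := by
  classical
  intro t K r a g hg
  let lab : (Fin t → Option (Fin 4 × Bool)) → List (Fin (t * 4) × Bool) := fun s =>
    (List.finRange t).filterMap fun b => (s b).map fun q => (finProdFinEquiv (b, q.1), q.2)
  let mono : (Fin t → Option (Fin 4 × Bool)) → Matrix (QReg (t * 4)) (QReg (t * 4)) ℂ := fun s =>
    ((List.finRange t).filterMap fun b =>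
      (s b).map fun q => majorana (t * 4) (finProdFinEquiv (b, q.1)) q.2).prod
  have hmono_lab : ∀ s, mono s = ((lab s).map fun p => majorana (t * 4) p.1 p.2).prod := by
    intro s
    simp only [mono, lab, List.map_filterMap, Option.map_map]
    rfl
  let ι : Type := Σ B : {B : Finset (Fin t) // B.card = K}, (B.1 → Fin 4 × Bool)
  obtain ⟨W, hW, hmem⟩ := robust_deficiency (t * 4) K r a g hg
  have hunit : ∀ s, mono s ∈ Matrix.unitaryGroup (QReg (t * 4)) ℂ := by
    intro s
    rw [hmono_lab]
    refine list_prod_mem ?_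
    intro x hx
    obtain ⟨p, -, rfl⟩ := List.mem_map.1 hx
    exact majorana_mem_unitaryGroup _ _ _
  obtain ⟨hO1, hO2⟩ := robust_flatOrthonormal t mono (fun s => rfl)
  have hmass := stub_massBound (t * 4) ι (fun x => mono (robustPattern x)) (magicMPow t) (∑ i, a i • g i) W
    (fun x => hunit _) (fun x => hO1 _)
    (fun x y hxy => hO2 _ _ fun h => hxy (robustPattern_injective t K h))
    (fun x => by
      show mono (robustPattern x) *ᵥ _ ∈ W
      rw [hmono_lab]
      exact hmem (lab (robustPattern x))
        ((robust_length_filterMap_labels t (robustPattern x)).trans (robustPattern_support x)))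
  have hcardι : Fintype.card ι = t.choose K * 8 ^ K := countGap_card_sigma t K
  have hWR : (Module.finrank ℂ W : ℝ) ≤ ((r * flatteningDeficiency K (t * 4) : ℕ) : ℝ) := by
    exact_mod_cast hW
  rw [hcardι] at hmass
  push_cast at hmass hWR ⊢
  linarith

/-- **Support item `SpinorFlattening.FlatteningBoundExact` (stmt-QuantumAdvantage-1249)** — the `δ = 0` core:
under the same count, `M^{⊗t}` is not an `r`-term Gaussian combination (else `normSq 0 = 0` would contradict
`1 ≤ C(8t,K) · 0`). -/
theorem flatteningBoundExact :
    Summit.QuantumAdvantage.QuantumAdvantage.Theses.SpinorFlattening.FlatteningBoundExact := by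
  classical
  show ∀ t K r : ℕ, r * flatteningDeficiency K (t * 4) < t.choose K * 8 ^ K →
    ∀ (a : Fin r → ℂ) (g : Fin r → QReg (t * 4) → ℂ), (∀ i, IsGaussian (g i)) →
      magicMPow t ≠ ∑ i, a i • g i
  intro t K r hcount a g hg heq
  have h := flatteningBoundRobust
  rw [Summit.QuantumAdvantage.QuantumAdvantage.Theses.SpinorFlattening.FlatteningBoundRobust] at h
  have key : (1 : ℝ) ≤ ((t * 8).choose K : ℝ) * normSq (magicMPow t - ∑ i, a i • g i) :=
    h t K r hcount a g hg
  have h0 : normSq (magicMPow t - ∑ i, a i • g i) = 0 := by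
    rw [← heq, sub_self]
    simp [normSq]
  rw [h0, mul_zero] at key
  exact absurd key (by norm_num)

end Summit.QuantumAdvantage.QuantumAdvantage.Theorems.SpinorFlattening

end
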